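import Literature.AlgebraicGeometry.ModuliOfAbelianVarieties.SiegelPrincipalLevelCompact
import Literature.AlgebraicGeometry.ModuliOfAbelianVarieties.SiegelTransporterBounds
import Literature.AlgebraicGeometry.ModuliOfAbelianVarieties.SiegelPrincipalLevelMultiplier
import Literature.NumberTheory.Adeles.RatFiniteIdeleCongruenceClasses
import HarnessLib

/-!
# `ẑ = lim_M ℤ/Mℤ`: integral finite adèles of `ℚ` from compatible families of residues, and
# `GL_m(ẑ) = lim_M GL_m(ℤ/Mℤ)` (Cassels–Fröhlich II §15; Milne ISV §4)

Topic `NumberTheory/Adeles`; namespace `Literature.NumberTheory.Adeles`.  THEOREMS ONLY (no definition, no named fact, no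
instance, no `sorry`).  Cell hodgecm-mathlib (D-0151), rung-0 generic leaf (B-plan1 R55 «GO frame → B-p21»; U-DAG brick
B4 (d) input «FRAME ASSEMBLY»; also the `ẑ`-assembly road B-p18 avoided for B1): the INVERSE-LIMIT half of ★
`IntegralAdelesReductionModN` (which delivers only the reduction `ẑ → ℤ/N`, `GL_m(ẑ) → GL_m(ℤ/N)`).

Currency (★, def-free as in `IntegralAdelesReductionModN`): `finAdeleQ = 𝔸_{ℚ,f}`, `ẑ = FiniteAdeleRing.integralAdeles (𝓞 ℚ) ℚ`,
`levelIdeal M = M·ẑ`; a residue class mod `M` is carried by an INTEGER representative `a M : ℤ` and «`z ≡ a_M (mod M)`» is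
`z - a M ∈ levelIdeal M`; a compatible family over the tower `{M ; N ∣ M, M ≠ 0}` is `a : ℕ → ℤ` with
`M ∣ M′ ⟹ M ∣ a M′ − a M`, all levels non-zero.

* §1 **`existsUnique_mem_integralAdeles_forall_sub_intCast_mem_levelIdeal`** — every compatible family of residues over
  the tower `N ∣ M` is the family of residues of a UNIQUE `z ∈ ẑ`.  Existence by COMPACTNESS of `ẑ` (★
  `isCompact_integralAdeles`) and the finite-intersection property of the closed cosets `a_M + M·ẑ` (★ `isClosed_levelIdeal`;
  a finite set of levels has a common multiple `L` in the tower and the integer `a_L` lies in all of them); uniqueness by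
  `⋂_M M·ẑ = 0` (★ `eq_zero_of_forall_mem_levelIdeal`).  `ZMod`-family form: `existsUnique_mem_integralAdeles_of_zmod_compatible`.
* §2 **matrices**: `existsUnique_matrix_integralAdeles_of_compatible` (entrywise), and
  **`exists_units_matrix_integralAdeles_of_compatible`** — a compatible family of integer matrices INVERTIBLE modulo every
  `M` of the tower assembles to `γ ∈ GL_m(ẑ)` (`γ, γ⁻¹` integral) with `γ ≡ A_M`, `γ⁻¹ ≡ B_M (mod M·ẑ)`; uniqueness
  `units_matrix_integralAdeles_unique_of_forall`.
* §3 **`exists_mem_principalLevelSubgroup_one_of_compatible`** — if moreover `A_Mᵀ E_δ A_M ≡ n_M · E_δ (mod M)` for a compatible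
  family of residues `n_M` invertible mod `M`, then `γ ∈ GSp_δ(𝔸_{ℚ,f})` with a `ẑ`-unit multiplier `ν ≡ n_M (mod M)` and
  `γ ∈ K_δ(1) = GSp_δ(ẑ)` — ONE adelic symplectic frame from a full compatible tower of symplectic-similitude frames.

## References
* [CasselsFrohlichANT1967] J. W. S. Cassels, A. Fröhlich (eds.), *Algebraic Number Theory* (1967), Ch. II §15–§16
  (`ẑ = lim ℤ/nℤ = ∏_p ℤ_p`, `ẑ/nẑ = ℤ/nℤ`).
* [Milne2005ShimuraVarieties] J. S. Milne, *Introduction to Shimura varieties* (2005), §4 p. 48 («`ẑ = lim ℤ/mℤ`», congruence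
  subgroups), §6 p. 70 (`K(N)`).
* [PlatonovRapinchuk1994] V. Platonov, A. Rapinchuk, *Algebraic groups and number theory* (1994), Ch. 5 §5.1 (compactness of `𝓞̂`).
-/

set_option autoImplicit false

noncomputable section

open NumberField IsDedekindDomain Matrix Topology
open Literature.AlgebraicGeometry.ModuliOfAbelianVarieties

namespace Literature.NumberTheory.Adeles

/-! ### §1. `ẑ = lim_{N ∣ M} ℤ/Mℤ` -/

/-- **Uniqueness in `ẑ = lim ℤ/Mℤ`**: two finite adèles with the same residues along the tower `{M ; N ∣ M, M ≠ 0}` are equal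
(their difference lies in `M·ẑ` for every `M ≠ 0`, ★ `eq_zero_of_forall_mem_levelIdeal`). [cite: CasselsFrohlichANT1967, Ch. II §15] -/
theorem eq_of_forall_sub_intCast_mem_levelIdeal {N : ℕ} (hN : N ≠ 0) (a : ℕ → ℤ) {z z' : finAdeleQ}
    (hz : ∀ M, M ≠ 0 → N ∣ M → z - (a M : finAdeleQ) ∈ levelIdeal M)
    (hz' : ∀ M, M ≠ 0 → N ∣ M → z' - (a M : finAdeleQ) ∈ levelIdeal M) : z = z' := by
  rw [← sub_eq_zero]
  refine eq_zero_of_forall_mem_levelIdeal fun n hn => ?_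
  have hNn : N * n ≠ 0 := mul_ne_zero hN hn
  have h := sub_mem (hz (N * n) hNn (dvd_mul_right N n)) (hz' (N * n) hNn (dvd_mul_right N n))
  rw [sub_sub_sub_cancel_right] at h
  exact levelIdeal_anti (dvd_mul_left n N) h

/-- **`ẑ = lim_{N ∣ M} ℤ/Mℤ` (existence and uniqueness)**: for `N ≠ 0` and a COMPATIBLE family of integer residues
`a : ℕ → ℤ` along the tower of levels divisible by `N` (`M ∣ M′ ⟹ M ∣ a M′ − a M`), there is a unique integral finite adèle
`z ∈ ẑ` with `z ≡ a_M (mod M·ẑ)` for every `M ≠ 0` with `N ∣ M`.  Existence: `ẑ` is compact (★ `isCompact_integralAdeles`) and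
the closed cosets `a_M + M·ẑ` (★ `isClosed_levelIdeal`) have the finite-intersection property — finitely many levels
`M₁, …, M_k` of the tower have the common multiple `L = N·∏ Mᵢ` in the tower, and the INTEGER `a_L` lies in every
`a_{Mᵢ} + Mᵢ·ẑ` by compatibility (★ `intCast_mem_levelIdeal_iff`: `ℤ ∩ M·ẑ = Mℤ`).  Uniqueness: `⋂_M M·ẑ = 0`.
[cite: CasselsFrohlichANT1967, Ch. II §15] [cite: Milne2005ShimuraVarieties, §4 p. 48] [cite: PlatonovRapinchuk1994, Ch. 5 §5.1] -/
theorem existsUnique_mem_integralAdeles_forall_sub_intCast_mem_levelIdeal {N : ℕ} (hN : N ≠ 0) (a : ℕ → ℤ)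
    (ha : ∀ M M' : ℕ, M ≠ 0 → M' ≠ 0 → N ∣ M → M ∣ M' → (M : ℤ) ∣ a M' - a M) :
    ∃! z : finAdeleQ, z ∈ FiniteAdeleRing.integralAdeles (𝓞 ℚ) ℚ ∧
      ∀ M, M ≠ 0 → N ∣ M → z - (a M : finAdeleQ) ∈ levelIdeal M := by
  haveI := t2Space_finAdeleQ
  -- the index type of the tower and the closed cosets `a_M + M·ẑ`
  let ι := {M : ℕ // M ≠ 0 ∧ N ∣ M}
  let t : ι → Set finAdeleQ := fun i => {z | z - (a i.1 : finAdeleQ) ∈ levelIdeal i.1}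
  have htc : ∀ i, IsClosed (t i) := fun i =>
    (isClosed_levelIdeal i.2.1).preimage (continuous_id.sub continuous_const)
  -- finite-intersection property
  have hst : ∀ u : Finset ι, ((FiniteAdeleRing.integralAdeles (𝓞 ℚ) ℚ : Set finAdeleQ) ∩ ⋂ i ∈ u, t i).Nonempty := by
    intro u
    -- common multiple `L = N * ∏_{i ∈ u} i` in the tower
    set L : ℕ := N * ∏ i ∈ u, i.1 with hL
    have hL0 : L ≠ 0 := mul_ne_zero hN (Finset.prod_ne_zero_iff.2 fun i _ => i.2.1)
    have hNL : N ∣ L := dvd_mul_right N _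
    refine ⟨(a L : finAdeleQ), intCast_mem_integralAdeles (a L), ?_⟩
    simp only [Set.mem_iInter]
    intro i hi
    change (a L : finAdeleQ) - (a i.1 : finAdeleQ) ∈ levelIdeal i.1
    have hiL : i.1 ∣ L := (Finset.dvd_prod_of_mem (fun j : ι => j.1) hi).trans (dvd_mul_left _ N)
    rw [← Int.cast_sub, intCast_mem_levelIdeal_iff i.2.1]
    exact ha i.1 L i.2.1 hL0 i.2.2 hiL
  obtain ⟨z, hzint, hzt⟩ := (isCompact_integralAdeles ℚ).inter_iInter_nonempty t htc hst
  refine ⟨z, ⟨hzint, fun M hM hNM => ?_⟩, ?_⟩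
  · exact Set.mem_iInter.1 hzt ⟨M, hM, hNM⟩
  · rintro z' ⟨-, hz'⟩
    exact eq_of_forall_sub_intCast_mem_levelIdeal hN a hz' fun M hM hNM => Set.mem_iInter.1 hzt ⟨M, hM, hNM⟩

/-- **`ZMod`-family form of `ẑ = lim ℤ/Mℤ`**: a family `x_M ∈ ℤ/Mℤ` over the tower `N ∣ M`, compatible under the canonical
maps `ℤ/M′ → ℤ/M` (`ZMod.castHom`), is the family of residues of a unique `z ∈ ẑ` (residues read on the representatives
`(x_M).val`). [cite: CasselsFrohlichANT1967, Ch. II §15] [cite: Milne2005ShimuraVarieties, §4 p. 48] -/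
theorem existsUnique_mem_integralAdeles_of_zmod_compatible {N : ℕ} (hN : N ≠ 0) (x : (M : ℕ) → ZMod M)
    (hx : ∀ M M' : ℕ, M ≠ 0 → M' ≠ 0 → N ∣ M → (h : M ∣ M') → ZMod.castHom h (ZMod M) (x M') = x M) :
    ∃! z : finAdeleQ, z ∈ FiniteAdeleRing.integralAdeles (𝓞 ℚ) ℚ ∧
      ∀ M, M ≠ 0 → N ∣ M → z - ((x M).val : ℕ) ∈ levelIdeal M := by
  have h := existsUnique_mem_integralAdeles_forall_sub_intCast_mem_levelIdeal hN (fun M => ((x M).val : ℤ))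
    (fun M M' hM hM' hNM hMM' => by
      haveI : NeZero M := ⟨hM⟩
      haveI : NeZero M' := ⟨hM'⟩
      rw [← ZMod.intCast_eq_intCast_iff_dvd_sub, Int.cast_natCast, Int.cast_natCast, ZMod.natCast_zmod_val,
        ← hx M M' hM hM' hNM hMM', ZMod.castHom_apply, ZMod.cast_eq_val])
  simpa only [Int.cast_natCast] using h

/-! ### §2. `M_m(ẑ) = lim M_m(ℤ/M)` and `GL_m(ẑ) = lim GL_m(ℤ/M)` -/

variable {m : Type} [Fintype m] [DecidableEq m]

omit [Fintype m] [DecidableEq m] in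
/-- **`M_m(ẑ) = lim_{N ∣ M} M_m(ℤ/Mℤ)`** (entrywise `ẑ = lim ℤ/Mℤ`): a compatible family of integer matrices along the tower is
the family of residues of a unique matrix with entries in `ẑ`. [cite: CasselsFrohlichANT1967, Ch. II §15] [cite: Milne2005ShimuraVarieties, §4 p. 48] -/
theorem existsUnique_matrix_integralAdeles_of_compatible {N : ℕ} (hN : N ≠ 0) (A : ℕ → Matrix m m ℤ)
    (hA : ∀ M M' : ℕ, M ≠ 0 → M' ≠ 0 → N ∣ M → M ∣ M' → ∀ i j, (M : ℤ) ∣ A M' i j - A M i j) :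
    ∃! X : Matrix m m finAdeleQ, (∀ i j, X i j ∈ FiniteAdeleRing.integralAdeles (𝓞 ℚ) ℚ) ∧
      ∀ M, M ≠ 0 → N ∣ M → ∀ i j, X i j - (A M i j : finAdeleQ) ∈ levelIdeal M := by
  have h := fun i j => existsUnique_mem_integralAdeles_forall_sub_intCast_mem_levelIdeal hN (fun M => A M i j)
    (fun M M' hM hM' hNM hMM' => hA M M' hM hM' hNM hMM' i j)
  choose z hz using fun i j => (h i j).exists
  refine ⟨Matrix.of fun i j => z i j, ⟨fun i j => (hz i j).1, fun M hM hNM i j => (hz i j).2 M hM hNM⟩, ?_⟩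
  rintro X ⟨hXint, hX⟩
  refine Matrix.ext fun i j => ?_
  exact (h i j).unique ⟨hXint i j, fun M hM hNM => hX M hM hNM i j⟩ ⟨(hz i j).1, (hz i j).2⟩

omit [Fintype m] [DecidableEq m] in
/-- **Matrices over `ẑ` congruent modulo every level of the tower are equal** (entrywise `⋂_M M·ẑ = 0`).
[cite: CasselsFrohlichANT1967, Ch. II §15] -/
theorem matrix_eq_of_forall_sub_apply_mem_levelIdeal {N : ℕ} (hN : N ≠ 0) {X Y : Matrix m m finAdeleQ}
    (h : ∀ M, M ≠ 0 → N ∣ M → ∀ i j, X i j - Y i j ∈ levelIdeal M) : X = Y := by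
  refine Matrix.ext fun i j => ?_
  rw [← sub_eq_zero]
  refine eq_zero_of_forall_mem_levelIdeal fun n hn => ?_
  exact levelIdeal_anti (dvd_mul_left n N) (h (N * n) (mul_ne_zero hN hn) (dvd_mul_right N n) i j)

/-- An integer matrix congruence `A ≡ B (mod M)` entrywise transfers to the adelic casts: `A i j - B i j ∈ M·ẑ`.
[cite: CasselsFrohlichANT1967, Ch. II §15] -/
theorem intCast_sub_intCast_mem_levelIdeal_of_dvd {M : ℕ} (hM : M ≠ 0) {x y : ℤ} (h : (M : ℤ) ∣ x - y) :
    (x : finAdeleQ) - (y : finAdeleQ) ∈ levelIdeal M := by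
  rw [← Int.cast_sub, intCast_mem_levelIdeal_iff hM]
  exact h

/-- **`GL_m(ẑ) = lim_{N ∣ M} GL_m(ℤ/Mℤ)`**: a compatible family of integer matrices `A_M`, each INVERTIBLE modulo `M` with
compatible inverses `B_M` (`A_M B_M ≡ 1`, `B_M A_M ≡ 1 (mod M)`), assembles to `γ ∈ GL_m(𝔸_{ℚ,f})` with `γ, γ⁻¹` integral
(i.e. `γ ∈ GL_m(ẑ)`, the currency of ★ `isCompact_units_matrix_integralAdeles`) and `γ ≡ A_M`, `γ⁻¹ ≡ B_M (mod M·ẑ)` for every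
level of the tower.  Proof: assemble `X ≡ A_M` and `Y ≡ B_M` (§1 entrywise); `XY − 1 ≡ 0` modulo every `M`, hence `XY = 1`
(`⋂_M M·ẑ = 0`), and likewise `YX = 1`. [cite: CasselsFrohlichANT1967, Ch. II §15] [cite: Milne2005ShimuraVarieties, §4 p. 48 and §6 p. 70] -/
theorem exists_units_matrix_integralAdeles_of_compatible {N : ℕ} (hN : N ≠ 0) (A B : ℕ → Matrix m m ℤ)
    (hA : ∀ M M' : ℕ, M ≠ 0 → M' ≠ 0 → N ∣ M → M ∣ M' → ∀ i j, (M : ℤ) ∣ A M' i j - A M i j)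
    (hB : ∀ M M' : ℕ, M ≠ 0 → M' ≠ 0 → N ∣ M → M ∣ M' → ∀ i j, (M : ℤ) ∣ B M' i j - B M i j)
    (hAB : ∀ M, M ≠ 0 → N ∣ M → ∀ i j, (M : ℤ) ∣ (A M * B M) i j - (1 : Matrix m m ℤ) i j)
    (hBA : ∀ M, M ≠ 0 → N ∣ M → ∀ i j, (M : ℤ) ∣ (B M * A M) i j - (1 : Matrix m m ℤ) i j) :
    ∃ γ : GL m finAdeleQ,
      (∀ i j, (γ : Matrix m m finAdeleQ) i j ∈ FiniteAdeleRing.integralAdeles (𝓞 ℚ) ℚ) ∧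
      (∀ i j, ((γ⁻¹ : GL m finAdeleQ) : Matrix m m finAdeleQ) i j ∈ FiniteAdeleRing.integralAdeles (𝓞 ℚ) ℚ) ∧
      (∀ M, M ≠ 0 → N ∣ M → ∀ i j, (γ : Matrix m m finAdeleQ) i j - (A M i j : finAdeleQ) ∈ levelIdeal M) ∧
      ∀ M, M ≠ 0 → N ∣ M → ∀ i j, ((γ⁻¹ : GL m finAdeleQ) : Matrix m m finAdeleQ) i j - (B M i j : finAdeleQ) ∈ levelIdeal M := by
  obtain ⟨X, ⟨hXint, hX⟩, -⟩ := existsUnique_matrix_integralAdeles_of_compatible hN A hA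
  obtain ⟨Y, ⟨hYint, hY⟩, -⟩ := existsUnique_matrix_integralAdeles_of_compatible hN B hB
  -- `X Y ≡ A_M B_M ≡ 1 (mod M)` for every level, hence `X Y = 1`; likewise `Y X = 1`
  have hmul : ∀ (P Q : Matrix m m finAdeleQ) (C D : ℕ → Matrix m m ℤ),
      (∀ i j, P i j ∈ FiniteAdeleRing.integralAdeles (𝓞 ℚ) ℚ) →
      (∀ i j, Q i j ∈ FiniteAdeleRing.integralAdeles (𝓞 ℚ) ℚ) →
      (∀ M, M ≠ 0 → N ∣ M → ∀ i j, P i j - (C M i j : finAdeleQ) ∈ levelIdeal M) →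
      (∀ M, M ≠ 0 → N ∣ M → ∀ i j, Q i j - (D M i j : finAdeleQ) ∈ levelIdeal M) →
      (∀ M, M ≠ 0 → N ∣ M → ∀ i j, (M : ℤ) ∣ (C M * D M) i j - (1 : Matrix m m ℤ) i j) →
      P * Q = 1 := by
    intro P Q C D hPint hQint hP hQ hCD
    refine matrix_eq_of_forall_sub_apply_mem_levelIdeal hN fun M hM hNM i j => ?_
    -- `(PQ)_{ij} - (CD)_{ij} ∈ M·ẑ`
    have h1 : (P * Q) i j - ((C M * D M) i j : finAdeleQ) ∈ levelIdeal M := by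
      rw [Matrix.mul_apply, Matrix.mul_apply, Int.cast_sum, ← Finset.sum_sub_distrib]
      refine sum_mem fun k _ => ?_
      rw [Int.cast_mul]
      have e : P i k * Q k j - (C M i k : finAdeleQ) * (D M k j : finAdeleQ) =
          (P i k - C M i k) * Q k j + (C M i k : finAdeleQ) * (Q k j - D M k j) := by ring
      rw [e]
      exact add_mem
        (by rw [mul_comm]; exact mul_mem_levelIdeal_of_mem_integralAdeles (hQint k j) (hP M hM hNM i k))
        (mul_mem_levelIdeal_of_mem_integralAdeles (intCast_mem_integralAdeles _) (hQ M hM hNM k j))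
    -- `(CD)_{ij} - 1_{ij} ∈ M·ẑ`
    have h2 : ((C M * D M) i j : finAdeleQ) - (1 : Matrix m m finAdeleQ) i j ∈ levelIdeal M := by
      have h3 := intCast_sub_intCast_mem_levelIdeal_of_dvd hM (hCD M hM hNM i j)
      have e1 : (((1 : Matrix m m ℤ) i j : ℤ) : finAdeleQ) = (1 : Matrix m m finAdeleQ) i j := by
        rw [Matrix.one_apply, Matrix.one_apply]; split_ifs <;> simp
      rwa [e1] at h3
    have h4 := add_mem h1 h2
    rwa [sub_add_sub_cancel] at h4
  have hXY : X * Y = 1 := hmul X Y A B hXint hYint hX hY hAB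
  have hYX : Y * X = 1 := hmul Y X B A hYint hXint hY hX hBA
  refine ⟨⟨X, Y, hXY, hYX⟩, hXint, hYint, hX, hY⟩

/-- **Uniqueness of the assembled unit**: an element of `GL_m(𝔸_{ℚ,f})` is determined by its residues along the tower
(entrywise `⋂_M M·ẑ = 0`). [cite: CasselsFrohlichANT1967, Ch. II §15] -/
theorem units_matrix_eq_of_forall_sub_apply_mem_levelIdeal {N : ℕ} (hN : N ≠ 0) {γ γ' : GL m finAdeleQ}
    (h : ∀ M, M ≠ 0 → N ∣ M → ∀ i j,
      (γ : Matrix m m finAdeleQ) i j - (γ' : Matrix m m finAdeleQ) i j ∈ levelIdeal M) : γ = γ' :=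
  Units.ext (matrix_eq_of_forall_sub_apply_mem_levelIdeal hN h)

/-! ### §3. `GSp_δ(ẑ) = lim GSp_δ(ℤ/M)`: one adelic symplectic frame from a compatible tower of frames -/

/-- Scalar product rule for congruences: `p ≡ c`, `q ≡ d (mod M·ẑ)` with `q` and `c` integral ⟹ `pq ≡ cd (mod M·ẑ)`.
[cite: CasselsFrohlichANT1967, Ch. II §15] -/
theorem mul_sub_mul_mem_levelIdeal {M : ℕ} {p q c d : finAdeleQ}
    (hq : q ∈ FiniteAdeleRing.integralAdeles (𝓞 ℚ) ℚ) (hc : c ∈ FiniteAdeleRing.integralAdeles (𝓞 ℚ) ℚ)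
    (hp : p - c ∈ levelIdeal M) (hq' : q - d ∈ levelIdeal M) : p * q - c * d ∈ levelIdeal M := by
  have e : p * q - c * d = (p - c) * q + c * (q - d) := by ring
  rw [e]
  exact add_mem (by rw [mul_comm]; exact mul_mem_levelIdeal_of_mem_integralAdeles hq hp)
    (mul_mem_levelIdeal_of_mem_integralAdeles hc hq')

omit [DecidableEq m] in
/-- Matrix product rule for congruences: `P ≡ C`, `Q ≡ D (mod M·ẑ)` entrywise, `Q` integral and `C` an integer matrix ⟹
`PQ ≡ CD (mod M·ẑ)` entrywise. [cite: CasselsFrohlichANT1967, Ch. II §15] -/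
theorem mul_apply_sub_intCast_mul_apply_mem_levelIdeal {M : ℕ} {P Q : Matrix m m finAdeleQ} {C D : Matrix m m ℤ}
    (hQ : ∀ i j, Q i j ∈ FiniteAdeleRing.integralAdeles (𝓞 ℚ) ℚ)
    (hP : ∀ i j, P i j - (C i j : finAdeleQ) ∈ levelIdeal M) (hQ' : ∀ i j, Q i j - (D i j : finAdeleQ) ∈ levelIdeal M)
    (i j : m) : (P * Q) i j - ((C * D) i j : finAdeleQ) ∈ levelIdeal M := by
  rw [Matrix.mul_apply, Matrix.mul_apply, Int.cast_sum, ← Finset.sum_sub_distrib]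
  refine sum_mem fun k _ => ?_
  rw [Int.cast_mul]
  exact mul_sub_mul_mem_levelIdeal (hQ k j) (intCast_mem_integralAdeles _) (hP i k) (hQ' k j)

omit [Fintype m] in
/-- A matrix with entries in `ẑ` is `≡ 1 (mod 1·ẑ)` (the level-`1` congruence is integrality; converse of ★
`isIntegral_of_isCongOne_one`). [cite: Deligne1971TravauxShimura, Exemple 4.16 p. 150] -/
theorem isCongOne_one_of_forall_mem_integralAdeles {A : Matrix m m finAdeleQ}
    (hA : ∀ i j, A i j ∈ FiniteAdeleRing.integralAdeles (𝓞 ℚ) ℚ) : IsCongOne 1 A := by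
  intro i j
  have h1 : (1 : Matrix m m finAdeleQ) i j ∈ FiniteAdeleRing.integralAdeles (𝓞 ℚ) ℚ := by
    rw [Matrix.one_apply]; split_ifs; exacts [one_mem _, zero_mem _]
  rw [Matrix.sub_apply]
  exact mem_levelIdeal_iff.2 ⟨_, sub_mem (hA i j) h1, by rw [Nat.cast_one, one_mul]⟩

/-- **A `ẑ`-UNIT from a compatible family of residues invertible modulo every level**: if `n_M n′_M ≡ 1 (mod M)` along the
tower for compatible families `n, n′`, the assembled `ν ≡ n_M` is a unit of `𝔸_{ℚ,f}` with `|ν_v|_v = 1` everywhere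
(its inverse is the assembled `ν′ ≡ n′_M`; `νν′ ≡ 1` modulo every `M`, hence `νν′ = 1`). [cite: CasselsFrohlichANT1967, Ch. II §15–§16] -/
theorem exists_units_forall_valued_eq_one_of_compatible {N : ℕ} (hN : N ≠ 0) (n n' : ℕ → ℤ)
    (hn : ∀ M M' : ℕ, M ≠ 0 → M' ≠ 0 → N ∣ M → M ∣ M' → (M : ℤ) ∣ n M' - n M)
    (hn' : ∀ M M' : ℕ, M ≠ 0 → M' ≠ 0 → N ∣ M → M ∣ M' → (M : ℤ) ∣ n' M' - n' M)
    (hnn' : ∀ M, M ≠ 0 → N ∣ M → (M : ℤ) ∣ n M * n' M - 1) :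
    ∃ ν : finAdeleQˣ, (∀ v, Valued.v ((ν : finAdeleQ) v) = 1) ∧
      ∀ M, M ≠ 0 → N ∣ M → (ν : finAdeleQ) - (n M : finAdeleQ) ∈ levelIdeal M := by
  obtain ⟨z, ⟨hzint, hz⟩, -⟩ := existsUnique_mem_integralAdeles_forall_sub_intCast_mem_levelIdeal hN n hn
  obtain ⟨z', ⟨hz'int, hz'⟩, -⟩ := existsUnique_mem_integralAdeles_forall_sub_intCast_mem_levelIdeal hN n' hn'
  -- `z z' ≡ n_M n'_M ≡ 1` modulo every level, hence `z z' = 1`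
  have hzz' : z * z' = 1 := by
    rw [← sub_eq_zero]
    refine eq_zero_of_forall_mem_levelIdeal fun k hk => ?_
    have hM : N * k ≠ 0 := mul_ne_zero hN hk
    have h1 : z * z' - (n (N * k) : finAdeleQ) * (n' (N * k) : finAdeleQ) ∈ levelIdeal (N * k) :=
      mul_sub_mul_mem_levelIdeal hz'int (intCast_mem_integralAdeles _) (hz _ hM (dvd_mul_right N k))
        (hz' _ hM (dvd_mul_right N k))
    have h2 : (n (N * k) : finAdeleQ) * (n' (N * k) : finAdeleQ) - 1 ∈ levelIdeal (N * k) := by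
      have h3 := intCast_sub_intCast_mem_levelIdeal_of_dvd hM (hnn' _ hM (dvd_mul_right N k))
      rwa [Int.cast_mul, Int.cast_one] at h3
    have h4 := add_mem h1 h2
    rw [sub_add_sub_cancel] at h4
    exact levelIdeal_anti (dvd_mul_left k N) h4
  refine ⟨⟨z, z', hzz', by rw [mul_comm]; exact hzz'⟩, ?_, hz⟩
  exact (forall_valued_eq_one_iff_mem_integralAdeles _).2 ⟨hzint, hz'int⟩

variable {g : ℕ} (δ : Fin g → ℕ)

/-- **`GSp_δ(ẑ) = lim_{N ∣ M} GSp_δ(ℤ/Mℤ)` — ONE ADELIC SYMPLECTIC FRAME FROM A COMPATIBLE TOWER OF FRAMES.**  Let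
`A_M, B_M ∈ M_{2g}(ℤ)` (`N ∣ M`) be compatible families, mutually inverse modulo `M`, and SYMPLECTIC SIMILITUDES modulo `M`:
`A_Mᵀ E_δ A_M ≡ n_M · E_δ (mod M)` for a compatible family of residues `n_M` with inverses `n′_M`.  Then there are
`γ ∈ K_δ(1) = GSp_δ(ẑ)` and a `ẑ`-unit multiplier `ν` (`γᵀ E_δ γ = ν E_δ`, `|ν_v|_v = 1`) with `γ ≡ A_M`, `γ⁻¹ ≡ B_M`,
`ν ≡ n_M (mod M·ẑ)` along the tower — the adelic frame `k₀` of a full compatible tower of symplectic level frames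
(e.g. a symplectic lift read through a level-one marking; cell hodgecm-mathlib U-DAG B4 (d)).  Everything is checked
modulo every `M` and transferred by `⋂_M M·ẑ = 0`. [cite: Milne2005ShimuraVarieties, §4 p. 48 and §6 p. 70]
[cite: Deligne1971TravauxShimura, 4.12 (b) pp. 148–149 («k : T̂(B) → V_ẑ» from the «k_n»)] [cite: CasselsFrohlichANT1967, Ch. II §15] -/
theorem exists_mem_principalLevelSubgroup_one_of_compatible {N : ℕ} (hN : N ≠ 0)
    (A B : ℕ → Matrix (Fin g ⊕ Fin g) (Fin g ⊕ Fin g) ℤ) (n n' : ℕ → ℤ)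
    (hA : ∀ M M' : ℕ, M ≠ 0 → M' ≠ 0 → N ∣ M → M ∣ M' → ∀ i j, (M : ℤ) ∣ A M' i j - A M i j)
    (hB : ∀ M M' : ℕ, M ≠ 0 → M' ≠ 0 → N ∣ M → M ∣ M' → ∀ i j, (M : ℤ) ∣ B M' i j - B M i j)
    (hAB : ∀ M, M ≠ 0 → N ∣ M → ∀ i j, (M : ℤ) ∣ (A M * B M) i j - (1 : Matrix _ _ ℤ) i j)
    (hBA : ∀ M, M ≠ 0 → N ∣ M → ∀ i j, (M : ℤ) ∣ (B M * A M) i j - (1 : Matrix _ _ ℤ) i j)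
    (hn : ∀ M M' : ℕ, M ≠ 0 → M' ≠ 0 → N ∣ M → M ∣ M' → (M : ℤ) ∣ n M' - n M)
    (hn' : ∀ M M' : ℕ, M ≠ 0 → M' ≠ 0 → N ∣ M → M ∣ M' → (M : ℤ) ∣ n' M' - n' M)
    (hnn' : ∀ M, M ≠ 0 → N ∣ M → (M : ℤ) ∣ n M * n' M - 1)
    (hsymp : ∀ M, M ≠ 0 → N ∣ M → ∀ i j,
      (M : ℤ) ∣ ((A M)ᵀ * typeForm δ * A M) i j - (n M • typeForm δ) i j) :
    ∃ (γ : gspFinAdelic δ) (ν : finAdeleQˣ),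
      γ ∈ principalLevelSubgroup δ 1 ∧
      IsMultiplier (typeFormOver δ finAdeleQ) (γ : GL (Fin g ⊕ Fin g) finAdeleQ) ν ∧
      (∀ v, Valued.v ((ν : finAdeleQ) v) = 1) ∧
      (∀ M, M ≠ 0 → N ∣ M → (ν : finAdeleQ) - (n M : finAdeleQ) ∈ levelIdeal M) ∧
      (∀ M, M ≠ 0 → N ∣ M → ∀ i j,
        ((γ : GL (Fin g ⊕ Fin g) finAdeleQ) : Matrix _ _ finAdeleQ) i j - (A M i j : finAdeleQ) ∈ levelIdeal M) ∧
      ∀ M, M ≠ 0 → N ∣ M → ∀ i j,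
        (((γ : GL (Fin g ⊕ Fin g) finAdeleQ)⁻¹ : GL _ finAdeleQ) : Matrix _ _ finAdeleQ) i j - (B M i j : finAdeleQ) ∈
          levelIdeal M := by
  obtain ⟨γ₀, hγint, hγinv, hγA, hγB⟩ := exists_units_matrix_integralAdeles_of_compatible hN A B hA hB hAB hBA
  obtain ⟨ν, hν1, hνn⟩ := exists_units_forall_valued_eq_one_of_compatible hN n n' hn hn' hnn'
  -- the multiplier identity `γ₀ᵀ E γ₀ = ν E`, checked modulo every level
  have hE : ∀ (M : ℕ) a b, typeFormOver δ finAdeleQ a b - (typeForm δ a b : finAdeleQ) ∈ levelIdeal M := fun M a b => by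
    rw [typeFormOver_apply, sub_self]; exact zero_mem _
  have hmult : IsMultiplier (typeFormOver δ finAdeleQ) γ₀ ν := by
    rw [isMultiplier_iff]
    refine matrix_eq_of_forall_sub_apply_mem_levelIdeal hN fun M hM hNM i j => ?_
    -- `(γ₀ᵀ E γ₀)_{ij} ≡ (A_Mᵀ E A_M)_{ij}`
    have hT : ∀ a b, (((γ₀ : Matrix (Fin g ⊕ Fin g) (Fin g ⊕ Fin g) finAdeleQ))ᵀ * typeFormOver δ finAdeleQ) a b -
        ((((A M)ᵀ * typeForm δ) a b : ℤ) : finAdeleQ) ∈ levelIdeal M :=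
      mul_apply_sub_intCast_mul_apply_mem_levelIdeal
        (P := ((γ₀ : Matrix (Fin g ⊕ Fin g) (Fin g ⊕ Fin g) finAdeleQ))ᵀ) (Q := typeFormOver δ finAdeleQ)
        (C := (A M)ᵀ) (D := typeForm δ)
        (fun a b => typeFormOver_apply_mem_integralAdeles δ a b)
        (fun a b => by rw [Matrix.transpose_apply, Matrix.transpose_apply]; exact hγA M hM hNM b a)
        (fun a b => hE M a b)
    have h1 : (((γ₀ : Matrix (Fin g ⊕ Fin g) (Fin g ⊕ Fin g) finAdeleQ))ᵀ * typeFormOver δ finAdeleQ *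
          (γ₀ : Matrix (Fin g ⊕ Fin g) (Fin g ⊕ Fin g) finAdeleQ)) i j -
        ((((A M)ᵀ * typeForm δ * A M) i j : ℤ) : finAdeleQ) ∈ levelIdeal M :=
      mul_apply_sub_intCast_mul_apply_mem_levelIdeal
        (P := ((γ₀ : Matrix (Fin g ⊕ Fin g) (Fin g ⊕ Fin g) finAdeleQ))ᵀ * typeFormOver δ finAdeleQ)
        (Q := (γ₀ : Matrix (Fin g ⊕ Fin g) (Fin g ⊕ Fin g) finAdeleQ)) (C := (A M)ᵀ * typeForm δ) (D := A M)
        hγint hT (hγA M hM hNM) i j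
    -- `(A_Mᵀ E A_M)_{ij} ≡ n_M E_{ij}`
    have h2 : (((A M)ᵀ * typeForm δ * A M) i j : finAdeleQ) - ((n M • typeForm δ) i j : finAdeleQ) ∈ levelIdeal M :=
      intCast_sub_intCast_mem_levelIdeal_of_dvd hM (hsymp M hM hNM i j)
    -- `n_M E_{ij} ≡ ν E_{ij}`
    have h3 : ((n M • typeForm δ) i j : finAdeleQ) - ((ν : finAdeleQ) • typeFormOver δ finAdeleQ) i j ∈ levelIdeal M := by
      rw [Matrix.smul_apply, Matrix.smul_apply, smul_eq_mul, smul_eq_mul, Int.cast_mul, typeFormOver_apply,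
        ← sub_mul, ← neg_sub, neg_mul]
      exact neg_mem (mul_comm (typeForm δ i j : finAdeleQ) _ ▸
        mul_mem_levelIdeal_of_mem_integralAdeles (intCast_mem_integralAdeles _) (hνn M hM hNM))
    have h4 := add_mem (add_mem h1 h2) h3
    rwa [sub_add_sub_cancel, sub_add_sub_cancel] at h4
  refine ⟨⟨γ₀, ν, hmult⟩, ν, ?_, hmult, hν1, hνn, hγA, hγB⟩
  exact (mem_principalLevelSubgroup_iff δ).2
    ⟨isCongOne_one_of_forall_mem_integralAdeles hγint, isCongOne_one_of_forall_mem_integralAdeles hγinv⟩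


end Literature.NumberTheory.Adeles

end
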